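import Summits.QuantumFields.BalabanUV.T4Continuum.Support.NE7SliceIterationOrbitWeighted
import Summits.QuantumFields.BalabanUV.T4Continuum.Support.NE7SliceInitialState
import Summits.QuantumFields.BalabanUV.T4Continuum.Support.NE7SliceLimitWorkingRegion
import Summits.QuantumFields.BalabanUV.T4Continuum.Support.NE7CurvedSupLetter
import HarnessLib

/-!
# NE7SliceTheorem — THE NONLINEAR SLICE THEOREM FOR THE CORNER-FREE ENERGY SLICE `𝒯_E(W)` (memo ROAD-G99 §3.8 (B) ∕ §3.9 (S1); ROAD-G102 §3): from the pair's residual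
# near-representative `u₀` (unitary, `(tower)`-periodic, corner-trivial, `‖W(b)⁻¹U′^{u₀}(b) − 1‖ ≤ b`) the (S1) iteration `u ↦ e^{−ζ(u)}u` converges to a unitary `(tower)`-periodic gauge
# `u⋆` IN WHICH `U′` IS EXACTLY ON THE SLICE: `U′^{u⋆} = W·e^{X⋆}`, `T(u⋆) = X⋆ − rightInvW(φ(u⋆)) ∈ 𝒯_E(W)`, with `M·sup‖X⋆‖ ≤ S`, `sup‖h(u⋆)‖ ≤ S`, `S = 2Mb + 24dM·δ₀` —
# every currency k-free when `b ≍ ε∕M`, `x, x′ ≍ ε∕M²` (the curved sup letter (L) is the displayed hypothesis `hLet`; §2 discharges it at `d+1 ≥ 2` by `NE7CurvedSupLetter.curved_sup_letter`)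

Cell `pub-balaban`, rung (B)+1 sub-cell t4, lineage `b2b-balaban-t4-ne7-p1`, generation 102 (CRUX PROVER NE7 #1 = OWNER of BINDER row NE7).  Memo `t4/b2b-balaban-t4-ne7-p1-g102/ROAD-G102.md` §3.
Assembly of: `NE7SliceInitialState` (the near-representative is an admissible initial state, `Df(u₀) ≤ δ₀`), `NE7SliceIterationOrbitWeighted.slice_orbit_w` (k-uniform Cauchy engine run),
`NE7SliceLimitWorkingRegion.tangentPart_limit_mem_of_geometric` ∕ `workingRegion_of_limit` ∕ `tendsto_repLog` ∕ `tendsto_cornerLog` (row NE7b, gen 150: the limit inherits the working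
region and its tangent part is in the slice).
WHAT ([folklore]; 0 def, 0 sorry).  §1 **`slice_theorem`** (general `d ≥ 1`, (L) displayed) — conclusion also in the `hslice` shape of `NE7DecompOfDirectLettersSlice.decomp_of_directLetters_coarse`
(`X₀ := repLog W U′ u⋆`, `φ := coarseDatum L k W U′ u⋆`, every proof argument of `rightInvW`).  §2 **`slice_theorem_curved`** (dimension `d+1 ≥ 2`: (L) DISCHARGED by `curved_sup_letter`; `∃ K ε₁ > 0`
functions of `d, L, card n` — the price is `M²x ≤ ε₁`, which also gives the absorption `16K(d+1)·M²x ≤ 1∕2`).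
HONEST FRAMING (page 1): THIS IS (S1) of the supplier spec; (S2) — the DIRECT LETTERS (DL1)∕(DL2) for `φ(u⋆)` — is NOT here and NOT in the tree (memo ROAD-G102 §4 records what they hinge
on); nothing of Bałaban's asserted; NOT `hdecomp♭`, NOT NE7; spine 0∕9; finite T⁴ rung (B)+1 — NOT infinite volume, NOT mass gap, NOT BetaPertH, NOT Clay.  Continuum YM on T⁴ ⇐ BetaPertH ∧
nine spine estimates (0/9 proved); BetaPertH ⇐ (D1) ∧ (D4) ∧ CAP+tail; G-an2-4 gates asym, D1 and NE2/3/4.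
-/

set_option autoImplicit false

open scoped BigOperators Matrix.Norms.L2Operator Topology
open NormedSpace Finset Filter

namespace Summit.QuantumFields.BalabanUV.T4Continuum.NE7SliceTheorem

open Literature.MathematicalPhysics.QuantumFieldTheory.Balaban1983to89
open B7Prop1Explicit B7Prop2Explicit MatrixLog
open T4AveragingDeficitWall (IsUnitaryCfg IsSkewDir SmallField vary curlAt)
open T4AveragingDeficitWallBoundary (IsPeriodicCfg periodBox)
open AveragingDeficitPeriodicCounting (IsPeriodicDir)
open AveragingDeficitTwoLevelPrep (prop1Radius)
open AveragingDeficitMultiLevelPrep (cavgIter LevelSmall tower)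
open BlockAveragePushDirGauge (gaugeDir)
open NE3EnergyShapes (IsUnitarySite IsPeriodicSite)
open NE3RightInverseSupLetters (frameC supC)
open NE3HatInvCurlLetters (supCurlC)
open NE3QbarIterCovLiftPrep (cruxC)
open NE3SmoothRightInverseW (rightInvW)
open NE3LinearisedAverageSup (curvSum)
open NE7MeanZeroGaugeSliceW (energyBlockLandauW)
open SpreadLift (loopRad)
open NE7SliceIterationState
open NE7SliceIterationStateFacts
open NE7SliceIterationOrbit (region_sizes)
open NE7SliceIterationOrbitWeighted (weighted_region slice_orbit_w)
open NE7SliceInitialState (init_chart init_corner init_cornerLog init_weighted_size init_sliceDefect_le)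
open NE7SliceLimitWorkingRegion (workingRegion_of_limit tangentPart_limit_mem_of_geometric tendsto_repLog tendsto_cornerLog)
open NE7CurvedSupLetter (curved_sup_letter)

noncomputable section

variable {d : ℕ} {n : Type*} [Fintype n] [DecidableEq n]

section Slice

variable [Nonempty n] {L : ℕ} (hL : 2 ≤ L) (k : ℕ) {W : Site d → Fin d → (Matrix n n ℂ)ˣ} {x : ℝ} (hWu : IsUnitaryCfg W) (hx : 0 ≤ x) (hs : LevelSmall d L k x)
  (hWx : SmallField W x) (N : ℕ) [NeZero N] (hθ : cruxC d L * (((L : ℝ) ^ (k + 1)) ^ 2 * x) < 1) (U' : Site d → Fin d → (Matrix n n ℂ)ˣ)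
  (hWP : IsPeriodicCfg W ((tower L N (k + 1) : ℕ) : ℤ)) (hU'u : IsUnitaryCfg U') (hU'P : IsPeriodicCfg U' ((tower L N (k + 1) : ℕ) : ℤ))

/-! ## §1 The nonlinear slice theorem, (L) displayed -/

include hWP hU'u hU'P in
/-- **THE NONLINEAR SLICE THEOREM FOR `𝒯_E(W)`** (multi-level small-field class at level `k+1`, `d ≥ 1`, `L ≥ 2`, `M = L^{k+1}`; `W`, `U′` unitary `(tower)`-periodic, `SmallField W x`,
`SmallField U′ x′`; Poincaré parameter `θ_P ≤ 1∕2`; the curved sup letter (L) with constant `K ≥ 0` displayed as `hLet`, absorption `16Kd·M²x ≤ 1∕2`; `M²x ≤ 1`, `curvSum ≤ 2L∕3`,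
`cruxC·M²x ≤ 1∕2`).  REGIME (one smallness parameter `τ`): `0 ≤ τ ≤ 1`, `30000dτ ≤ 1`, `3·10⁶(1+16K)(1+d)³(1+frameC)(1+supC+supCurlC)·τ ≤ 1∕2`, `M²x, M²x′ ≤ τ`; the near-representative
`u₀` (unitary, `(tower)`-periodic, corner-trivial, `‖W(b)⁻¹U′^{u₀}(b) − 1‖ ≤ b ≤ 1∕64`) with its defect ceiling `δ₀` (`NE7SliceInitialState.init_sliceDefect_le`'s bound `≤ δ₀`, `6dM·δ₀ ≤ 10⁻⁴`,
`M·δ₀ ≤ τ`) and size ceiling `S` (`2Mb + 24dM·δ₀ ≤ S ≤ 10⁻⁴`, `S ≤ τ`).  CONCLUSION: a unitary `(tower)`-periodic `u⋆` with the chart `U′^{u⋆} = W·e^{X(u⋆)}`, `M·‖X(u⋆)‖ ≤ S`, corners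
`u⋆(M•z) = e^{h(u⋆) z}`, `‖h(u⋆)‖ ≤ S`, and `T(u⋆) ∈ 𝒯_E(W)` — stated also as the `hslice` binder of `decomp_of_directLetters_coarse` for `X₀ := X(u⋆)`, `φ := φ(u⋆)`. [folklore] -/
theorem slice_theorem (hd : 0 < d)
    (hθP : 4 * (d : ℝ) ^ 2 * ((L : ℝ) ^ (k + 1) - 1) ^ 2 * x + 16 * d * loopRad d L ((prop1Radius d L)^[k] x)
      + 4 * d * ((d : ℝ) - 1) * ((L : ℝ) ^ (k + 1) - 1) ^ 2 * x ≤ 1 / 2)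
    {K : ℝ} (hK : 0 ≤ K) (hKε : 16 * K * d * (((L : ℝ) ^ (k + 1)) ^ 2 * x) ≤ 1 / 2)
    (hLet : ∀ Y : Site d → Fin d → Matrix n n ℂ, Y ∈ energyBlockLandauW (d := d) (n := n) L N (k + 1) W →
      ∀ B : ℝ, (∀ (z : Site d) (μ ν : Fin d), μ ≠ ν → ‖curlAt W Y z μ ν‖ ≤ B) → ∀ (y : Site d) (κ : Fin d), ‖Y y κ‖ ≤ K * (L : ℝ) ^ (k + 1) * B)
    (hε : ((L : ℝ) ^ (k + 1)) ^ 2 * x ≤ 1) (hA : curvSum d L (k + 1) x ≤ 2 / 3 * L) (hθc : cruxC d L * (((L : ℝ) ^ (k + 1)) ^ 2 * x) ≤ 1 / 2)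
    {x' : ℝ} (hx'0 : 0 ≤ x') (hU'x : SmallField U' x')
    {τ : ℝ} (hτ0 : 0 ≤ τ) (hτ1 : τ ≤ 1) (hτs : 30000 * (d : ℝ) * τ ≤ 1)
    (hC : 3000000 * (1 + 16 * K) * (1 + (d : ℝ)) ^ 3 * (1 + frameC d L) * (1 + supC d L + supCurlC d L) * τ ≤ 1 / 2)
    (h4 : ((L : ℝ) ^ (k + 1)) ^ 2 * x ≤ τ) (h5 : ((L : ℝ) ^ (k + 1)) ^ 2 * x' ≤ τ)
    -- the near-representative
    {u₀ : Site d → (Matrix n n ℂ)ˣ} (hu₀ : IsUnitarySite u₀) (hu₀P : IsPeriodicSite u₀ ((tower L N (k + 1) : ℕ) : ℤ))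
    (hpin : ∀ z : Site d, u₀ (((L : ℤ) ^ (k + 1)) • z) = 1)
    {b : ℝ} (hb : ∀ (y : Site d) (κ : Fin d), ‖(((W y κ)⁻¹ * gaugeAct u₀ U' y κ : (Matrix n n ℂ)ˣ) : Matrix n n ℂ) - 1‖ ≤ b) (hb64 : b ≤ 1 / 64)
    -- its defect ceiling `δ₀` (the sizes `e_E`, `c_E` of `T(u₀)` at any values above their floors) and the size ceiling `S`
    {eE cE δ₀ S : ℝ}
    (heE : 2 * b + supC d L / ((L : ℝ) ^ (k + 1) * (1 - cruxC d L * (((L : ℝ) ^ (k + 1)) ^ 2 * x))) * ((3 + 12 * (d : ℝ)) * (L : ℝ) ^ (k + 1) * (2 * b)) ≤ eE)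
    (hcE : (x + x' + 48 * (2 * b) ^ 2) + supCurlC d L / (((L : ℝ) ^ (k + 1)) ^ 2 * (1 - cruxC d L * (((L : ℝ) ^ (k + 1)) ^ 2 * x))) * ((3 + 12 * (d : ℝ)) * (L : ℝ) ^ (k + 1) * (2 * b))
      ≤ cE)
    (hδ₀ : (eE + (2 * K * (L : ℝ) ^ (k + 1) * cE + 8 * K * (((L : ℝ) ^ (k + 1)) ^ 2 * x) * (frameC d L * (L : ℝ) ^ (k + 1) * eE + 0) / (L : ℝ) ^ (k + 1)
          + 16 * K * d * (((L : ℝ) ^ (k + 1)) ^ 2 * x) * eE)) + (frameC d L * (L : ℝ) ^ (k + 1) * eE + 0) / (L : ℝ) ^ (k + 1) ≤ δ₀)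
    (hδmax : 6 * (d : ℝ) * (L : ℝ) ^ (k + 1) * δ₀ ≤ 1 / 10000) (hMδ : (L : ℝ) ^ (k + 1) * δ₀ ≤ τ)
    (hSsum : 2 * (L : ℝ) ^ (k + 1) * b + 24 * d * (L : ℝ) ^ (k + 1) * δ₀ ≤ S) (hS4 : S ≤ 1 / 10000) (hSτ : S ≤ τ) :
    ∃ ustar : Site d → (Matrix n n ℂ)ˣ, IsUnitarySite ustar ∧ IsPeriodicSite ustar ((tower L N (k + 1) : ℕ) : ℤ) ∧
      gaugeAct ustar U' = vary W (repLog W U' ustar) 1 ∧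
      (∀ (y : Site d) (κ : Fin d), (L : ℝ) ^ (k + 1) * ‖repLog W U' ustar y κ‖ ≤ S) ∧
      (∀ z : Site d, ((ustar (((L : ℤ) ^ (k + 1)) • z) : (Matrix n n ℂ)ˣ) : Matrix n n ℂ) = exp (cornerLog L k ustar z)) ∧
      (∀ z : Site d, ‖cornerLog L k ustar z‖ ≤ S) ∧
      tangentPart hL k hWu hx hs hWx N hθ U' ustar ∈ energyBlockLandauW (d := d) (n := n) L N (k + 1) W ∧
      (∀ (hWu' : IsUnitaryCfg W) (hx' : 0 ≤ x) (hs' : LevelSmall d L k x) (hWx' : SmallField W x)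
          (hθ' : cruxC d L * (((L : ℝ) ^ (k + 1)) ^ 2 * x) < 1) (hφ : IsSkewDir (coarseDatum L k W U' ustar)),
        (fun y μ => repLog W U' ustar y μ - rightInvW hL k hWu' hx' hs' hWx' N hθ' hφ y μ) ∈ energyBlockLandauW (d := d) (n := n) L N (k + 1) W) := by
  have hM0 : 0 < (L : ℝ) ^ (k + 1) := by positivity
  have hM1 : (1 : ℝ) ≤ (L : ℝ) ^ (k + 1) := one_le_pow₀ (by exact_mod_cast (by omega : 1 ≤ L))
  have hb0 : 0 ≤ b := (norm_nonneg _).trans (hb 0 ⟨0, hd⟩)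
  -- the initial state
  have hchart₀ := init_chart U' hb hb64 (u₀ := u₀)
  have hcorner₀ := init_corner k hpin (u₀ := u₀)
  have hs₀ := init_weighted_size hL k N U' hpin hb hb64 hd (W := W)
  have hd₀ := (init_sliceDefect_le hL k hWu hx hs hWx N hθ U' hWP hU'u hU'P hu₀ hu₀P hpin hb hb64 hd hθP hK hKε hLet hε hA hx'0 hU'x heE hcE).trans hδ₀
  have hδ₀0 : 0 ≤ δ₀ := (sliceDefect_nonneg hL k hWu hx hs hWx N hθ U' u₀).trans hd₀
  have hSsum' : 2 * (L : ℝ) ^ (k + 1) * b + 12 * d * (L : ℝ) ^ (k + 1) * δ₀ / (1 - 1 / 2) ≤ S := by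
    have e : 12 * (d : ℝ) * (L : ℝ) ^ (k + 1) * δ₀ / (1 - 1 / 2) = 24 * d * (L : ℝ) ^ (k + 1) * δ₀ := by ring
    rw [e]; exact hSsum
  -- the orbit
  obtain ⟨ustar, hlu, hlP, hconv, hrate, horbit⟩ := slice_orbit_w hL k hWu hx hs hWx N hθ U' hWP hU'u hU'P hd hθP hK hKε hLet hε hA hθc hx'0 hU'x hτ0 hτ1 hτs hC hS4 hSτ
    hδmax hMδ h4 h5 hu₀ hu₀P hchart₀ hcorner₀ hδ₀0 le_rfl hs₀ hd₀ hSsum'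
  -- per-j working-region facts
  have hreg : ∀ j, (∀ y κ, (L : ℝ) ^ (k + 1) * ‖repLog W U' ((sliceStep hL k hWu hx hs hWx N hθ U')^[j] u₀) y κ‖ ≤ S) ∧
      (∀ z, ‖cornerLog L k ((sliceStep hL k hWu hx hs hWx N hθ U')^[j] u₀) z‖ ≤ S) := fun j => by
    obtain ⟨⟨-, hjP, -, -, -⟩, -, hΦ⟩ := horbit j
    obtain ⟨hX, hh, h10, -, -, -⟩ := region_sizes hL k N U' hWP hU'P hjP
    obtain ⟨h1, -, h2⟩ := weighted_region hL k N U' (hΦ.trans hSsum')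
    exact ⟨fun y κ => (mul_le_mul_of_nonneg_left (hX y κ) hM0.le).trans h1, fun z => (hh z).trans h2⟩
  have hXu : ∀ j y κ, ‖repLog W U' ((sliceStep hL k hWu hx hs hWx N hθ U')^[j] u₀) y κ‖ ≤ 1 / 8 := fun j y κ => by
    have h := (hreg j).1 y κ
    have h' : ‖repLog W U' ((sliceStep hL k hWu hx hs hWx N hθ U')^[j] u₀) y κ‖ ≤ S :=
      (le_mul_of_one_le_left (norm_nonneg _) hM1).trans h
    linarith
  have hhu : ∀ j z, ‖cornerLog L k ((sliceStep hL k hWu hx hs hWx N hθ U')^[j] u₀) z‖ ≤ 1 / 8 := fun j z => ((hreg j).2 z).trans (by linarith)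
  have hju : ∀ j, IsUnitarySite ((sliceStep hL k hWu hx hs hWx N hθ U')^[j] u₀) := fun j => (horbit j).1.1
  have hjP : ∀ j, IsPeriodicSite ((sliceStep hL k hWu hx hs hWx N hθ U')^[j] u₀) ((tower L N (k + 1) : ℕ) : ℤ) := fun j => (horbit j).1.2.1
  have hgu : ∀ j, gaugeAct ((sliceStep hL k hWu hx hs hWx N hθ U')^[j] u₀) U' = vary W (repLog W U' ((sliceStep hL k hWu hx hs hWx N hθ U')^[j] u₀)) 1 :=
    fun j => (horbit j).1.2.2.1
  have hcu : ∀ j z, ((((sliceStep hL k hWu hx hs hWx N hθ U')^[j] u₀) (((L : ℤ) ^ (k + 1)) • z) : (Matrix n n ℂ)ˣ) : Matrix n n ℂ)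
      = exp (cornerLog L k ((sliceStep hL k hWu hx hs hWx N hθ U')^[j] u₀) z) := fun j => (horbit j).1.2.2.2.1
  have hDf : ∀ j, sliceDefect hL k hWu hx hs hWx N hθ U' ((sliceStep hL k hWu hx hs hWx N hθ U')^[j] u₀) ≤ (1 / 2) ^ j * δ₀ := fun j => (horbit j).2.1
  have hrate' : ∀ j y, ‖((((sliceStep hL k hWu hx hs hWx N hθ U')^[j] u₀) y : (Matrix n n ℂ)ˣ) : Matrix n n ℂ) - (ustar y : (Matrix n n ℂ)ˣ)‖
      ≤ (12 * d * (L : ℝ) ^ (k + 1) * δ₀ / (1 - 1 / 2)) * (1 / 2) ^ j := fun j y => by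
    have h := hrate y j
    have e : 12 * (d : ℝ) * (L : ℝ) ^ (k + 1) * δ₀ * (1 / 2) ^ j / (1 - 1 / 2) = (12 * d * (L : ℝ) ^ (k + 1) * δ₀ / (1 - 1 / 2)) * (1 / 2) ^ j := by ring
    rw [e] at h; exact h
  -- the slice condition of the limit (row NE7b's F4d-iii)
  have hT := tangentPart_limit_mem_of_geometric hL k hWu hx hs hWx N hθ U' hWP hU'u hU'P hε hA (fun j => (sliceStep hL k hWu hx hs hWx N hθ U')^[j] u₀) ustar
    hju hjP hgu hXu hcu hhu hlu hlP hconv (by norm_num : (0 : ℝ) ≤ 1 / 2) (by norm_num : (1 / 2 : ℝ) < 1) hrate' hDf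
  obtain ⟨hgl, -, hcl, -⟩ := workingRegion_of_limit k hWu hU'u hju hlu hconv hgu hXu hcu hhu
  -- the sharp sizes of the limit
  have hXl : ∀ (y : Site d) (κ : Fin d), (L : ℝ) ^ (k + 1) * ‖repLog W U' ustar y κ‖ ≤ S := fun y κ => by
    have ht := ((tendsto_repLog hWu hU'u hju hlu hconv hgu hXu y κ).norm).const_mul ((L : ℝ) ^ (k + 1))
    exact le_of_tendsto' ht fun j => (hreg j).1 y κ
  have hhl : ∀ z : Site d, ‖cornerLog L k ustar z‖ ≤ S := fun z =>
    le_of_tendsto' (tendsto_cornerLog k hconv hcu hhu z).norm fun j => (hreg j).2 z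
  refine ⟨ustar, hlu, hlP, hgl, hXl, hcl, hhl, hT, fun hWu' hx' hs' hWx' hθ' hφ => ?_⟩
  have e : (fun y μ => repLog W U' ustar y μ - rightInvW hL k hWu' hx' hs' hWx' N hθ' hφ y μ) = tangentPart hL k hWu hx hs hWx N hθ U' ustar := by
    funext y μ; simp only [tangentPart, normalPart_eq hL k hWu hx hs hWx N hθ U' hφ]
  rw [e]; exact hT

end Slice

/-! ## §2 The nonlinear slice theorem at dimension `d + 1 ≥ 2`, the curved sup letter discharged -/

/-- **THE NONLINEAR SLICE THEOREM FOR `𝒯_E(W)`, UNCONDITIONAL** (dimension `d+1 ≥ 2`, `L ≥ 2`): `∃ K > 0, ∃ ε₁ > 0` (from `NE7CurvedSupLetter.curved_sup_letter`) such that `slice_theorem` holds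
with THIS `K` and without `hLet`∕`hKε`, at the price `M²x ≤ ε₁`. [folklore] -/
theorem slice_theorem_curved [Nonempty n] (hd : 1 ≤ d) {L : ℕ} (hL : 2 ≤ L) :
    ∃ K : ℝ, 0 < K ∧ ∃ ε₁ : ℝ, 0 < ε₁ ∧ ∀ (k N : ℕ) [NeZero N] (W U' : Site (d + 1) → Fin (d + 1) → (Matrix n n ℂ)ˣ) (x x' : ℝ)
      (hWu : IsUnitaryCfg W) (hx : 0 ≤ x) (hs : LevelSmall (d + 1) L k x) (hWx : SmallField W x) (hθ : cruxC (d + 1) L * (((L : ℝ) ^ (k + 1)) ^ 2 * x) < 1),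
      IsPeriodicCfg W ((tower L N (k + 1) : ℕ) : ℤ) → IsUnitaryCfg U' → IsPeriodicCfg U' ((tower L N (k + 1) : ℕ) : ℤ) →
      4 * (((d + 1 : ℕ) : ℝ)) ^ 2 * ((L : ℝ) ^ (k + 1) - 1) ^ 2 * x + 16 * ((d + 1 : ℕ) : ℝ) * loopRad (d + 1) L ((prop1Radius (d + 1) L)^[k] x)
        + 4 * ((d + 1 : ℕ) : ℝ) * ((((d + 1 : ℕ) : ℝ)) - 1) * ((L : ℝ) ^ (k + 1) - 1) ^ 2 * x ≤ 1 / 2 →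
      ((L : ℝ) ^ (k + 1)) ^ 2 * x ≤ ε₁ → ((L : ℝ) ^ (k + 1)) ^ 2 * x ≤ 1 → curvSum (d + 1) L (k + 1) x ≤ 2 / 3 * L → cruxC (d + 1) L * (((L : ℝ) ^ (k + 1)) ^ 2 * x) ≤ 1 / 2 →
      0 ≤ x' → SmallField U' x' →
      ∀ {τ : ℝ}, 0 ≤ τ → τ ≤ 1 → 30000 * ((d + 1 : ℕ) : ℝ) * τ ≤ 1 →
      3000000 * (1 + 16 * K) * (1 + ((d + 1 : ℕ) : ℝ)) ^ 3 * (1 + frameC (d + 1) L) * (1 + supC (d + 1) L + supCurlC (d + 1) L) * τ ≤ 1 / 2 →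
      ((L : ℝ) ^ (k + 1)) ^ 2 * x ≤ τ → ((L : ℝ) ^ (k + 1)) ^ 2 * x' ≤ τ →
      ∀ {u₀ : Site (d + 1) → (Matrix n n ℂ)ˣ}, IsUnitarySite u₀ → IsPeriodicSite u₀ ((tower L N (k + 1) : ℕ) : ℤ) → (∀ z : Site (d + 1), u₀ (((L : ℤ) ^ (k + 1)) • z) = 1) →
      ∀ {b : ℝ}, (∀ (y : Site (d + 1)) (κ : Fin (d + 1)), ‖(((W y κ)⁻¹ * gaugeAct u₀ U' y κ : (Matrix n n ℂ)ˣ) : Matrix n n ℂ) - 1‖ ≤ b) → b ≤ 1 / 64 →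
      ∀ {eE cE δ₀ S : ℝ},
      2 * b + supC (d + 1) L / ((L : ℝ) ^ (k + 1) * (1 - cruxC (d + 1) L * (((L : ℝ) ^ (k + 1)) ^ 2 * x))) * ((3 + 12 * ((d + 1 : ℕ) : ℝ)) * (L : ℝ) ^ (k + 1) * (2 * b)) ≤ eE →
      (x + x' + 48 * (2 * b) ^ 2) + supCurlC (d + 1) L / (((L : ℝ) ^ (k + 1)) ^ 2 * (1 - cruxC (d + 1) L * (((L : ℝ) ^ (k + 1)) ^ 2 * x)))
        * ((3 + 12 * ((d + 1 : ℕ) : ℝ)) * (L : ℝ) ^ (k + 1) * (2 * b)) ≤ cE →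
      (eE + (2 * K * (L : ℝ) ^ (k + 1) * cE + 8 * K * (((L : ℝ) ^ (k + 1)) ^ 2 * x) * (frameC (d + 1) L * (L : ℝ) ^ (k + 1) * eE + 0) / (L : ℝ) ^ (k + 1)
          + 16 * K * ((d + 1 : ℕ) : ℝ) * (((L : ℝ) ^ (k + 1)) ^ 2 * x) * eE)) + (frameC (d + 1) L * (L : ℝ) ^ (k + 1) * eE + 0) / (L : ℝ) ^ (k + 1) ≤ δ₀ →
      6 * ((d + 1 : ℕ) : ℝ) * (L : ℝ) ^ (k + 1) * δ₀ ≤ 1 / 10000 → (L : ℝ) ^ (k + 1) * δ₀ ≤ τ →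
      2 * (L : ℝ) ^ (k + 1) * b + 24 * ((d + 1 : ℕ) : ℝ) * (L : ℝ) ^ (k + 1) * δ₀ ≤ S → S ≤ 1 / 10000 → S ≤ τ →
    ∃ ustar : Site (d + 1) → (Matrix n n ℂ)ˣ, IsUnitarySite ustar ∧ IsPeriodicSite ustar ((tower L N (k + 1) : ℕ) : ℤ) ∧
      gaugeAct ustar U' = vary W (repLog W U' ustar) 1 ∧
      (∀ (y : Site (d + 1)) (κ : Fin (d + 1)), (L : ℝ) ^ (k + 1) * ‖repLog W U' ustar y κ‖ ≤ S) ∧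
      (∀ z : Site (d + 1), ((ustar (((L : ℤ) ^ (k + 1)) • z) : (Matrix n n ℂ)ˣ) : Matrix n n ℂ) = exp (cornerLog L k ustar z)) ∧
      (∀ z : Site (d + 1), ‖cornerLog L k ustar z‖ ≤ S) ∧
      tangentPart hL k hWu hx hs hWx N hθ U' ustar ∈ energyBlockLandauW (d := d + 1) (n := n) L N (k + 1) W ∧
      (∀ (hWu' : IsUnitaryCfg W) (hx' : 0 ≤ x) (hs' : LevelSmall (d + 1) L k x) (hWx' : SmallField W x)
          (hθ' : cruxC (d + 1) L * (((L : ℝ) ^ (k + 1)) ^ 2 * x) < 1) (hφ : IsSkewDir (coarseDatum L k W U' ustar)),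
        (fun y μ => repLog W U' ustar y μ - rightInvW hL k hWu' hx' hs' hWx' N hθ' hφ y μ) ∈ energyBlockLandauW (d := d + 1) (n := n) L N (k + 1) W) := by
  obtain ⟨K, hK, ε₀, hε₀, hcurved⟩ := curved_sup_letter (n := n) hd hL
  refine ⟨K, hK, min ε₀ (1 / (32 * K * ((d + 1 : ℕ) : ℝ) + 1)), lt_min hε₀ (by positivity), ?_⟩
  intro k N _ W U' x x' hWu hx hs hWx hθ hWP hU'u hU'P hθP hε1 hε hA hθc hx'0 hU'x τ hτ0 hτ1 hτs hC h4 h5 u₀ hu₀ hu₀P hpin b hb hb64 eE cE δ₀ S heE hcE hδ₀ hδmax hMδ hSsum hS4 hSτ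
  have hε0' : ((L : ℝ) ^ (k + 1)) ^ 2 * x ≤ ε₀ := hε1.trans (min_le_left _ _)
  have hKε : 16 * K * ((d + 1 : ℕ) : ℝ) * (((L : ℝ) ^ (k + 1)) ^ 2 * x) ≤ 1 / 2 := by
    have h1 : ((L : ℝ) ^ (k + 1)) ^ 2 * x ≤ 1 / (32 * K * ((d + 1 : ℕ) : ℝ) + 1) := hε1.trans (min_le_right _ _)
    have hpos : 0 < 32 * K * ((d + 1 : ℕ) : ℝ) + 1 := by positivity
    have h2 : 16 * K * ((d + 1 : ℕ) : ℝ) * (1 / (32 * K * ((d + 1 : ℕ) : ℝ) + 1)) ≤ 1 / 2 := by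
      rw [mul_one_div, div_le_iff₀ hpos]; nlinarith [hK.le, (Nat.cast_nonneg (d + 1) : (0:ℝ) ≤ ((d + 1 : ℕ) : ℝ))]
    exact (mul_le_mul_of_nonneg_left h1 (by positivity)).trans h2
  have hLet : ∀ Y : Site (d + 1) → Fin (d + 1) → Matrix n n ℂ, Y ∈ energyBlockLandauW (d := d + 1) (n := n) L N (k + 1) W →
      ∀ B : ℝ, (∀ (z : Site (d + 1)) (μ ν : Fin (d + 1)), μ ≠ ν → ‖curlAt W Y z μ ν‖ ≤ B) → ∀ (y : Site (d + 1)) (κ : Fin (d + 1)), ‖Y y κ‖ ≤ K * (L : ℝ) ^ (k + 1) * B :=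
    fun Y hY B hB y κ => hcurved k N W x hWu hWP hx hs hWx hε0' Y hY B hB y κ
  exact slice_theorem (d := d + 1) hL k hWu hx hs hWx N hθ U' hWP hU'u hU'P (Nat.succ_pos d) hθP hK.le hKε hLet hε hA hθc hx'0 hU'x hτ0 hτ1 hτs hC h4 h5
    hu₀ hu₀P hpin hb hb64 heE hcE hδ₀ hδmax hMδ hSsum hS4 hSτ


end

end Summit.QuantumFields.BalabanUV.T4Continuum.NE7SliceTheorem
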